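import Summits.QuantumFields.BalabanUV.Beta.FP.SymmetryInheritGeneric
import Summits.QuantumFields.BalabanUV.Beta.RowD1JointEnd
import Summits.QuantumFields.BalabanUV.Beta.FP.RoadRebasedHoldsBm

/-!
# `BalabanUV.Beta.FP.RoadRowD1` — road «FP» for binder row D1 AT THE LITERAL OF RECORD X-an2-51 `RowD1JointEnd.JsRowD1`: its four-family CLOSED
# FORM (block-mean rooted: `JsRowD1 = dressBmAt ρ_c ∘ JsRowD1Undressed`, `TbalOf_dressBmAt`), road FP's generic END instantiated there with the
# symmetry sockets fed by the FINITE-`j` ROWS (`FP/SymmetryInheritGeneric`), and the Ward row DISCHARGED by K-Q's hW theorem from an1's three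
# level-0 Ward letters — residual {Cauchy rows of the three unit-rescaled `m = 1` families, class data, the three hW LETTERS, hTj, hSDF, hasym}

HONEST DEPENDENCY (page 1, mandatory): continuum YM on T⁴ ⇐ BetaPertH ∧ nine spine estimates (0/9 proved); BetaPertH ⇐ (D1) ∧ (D4) ∧
CAP+tail; G-an2-4 gates asym, D1 and NE2/3/4.  HONEST FRAMING (cell contract, verbatim): «discharging `BetaPertH` makes Bałaban's UV
stability UNCONDITIONAL — a real constructive-QFT result; it is NOT the continuum limit and NOT the Clay problem.»  [our object] ONE name
(`JsRowD1Undressed` = the undressed recursive jets behind `JsRowD1`, a `def` asserting nothing) + [folklore] composition BY NAME of an2's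
`AxialDressingRootedBmHessian.TbalOf_dressBmAt`, leaf-01-g6's `FP/SymmetryInheritGeneric.d1Drift_of_generic_wardRow_swapRow_explicitDefect` (over the road FP
owner's `RoadEndGeneric` ∕ `StepLawWardGeneric`, R-FP-13) and an2-g21's K-Q `RowD1JointEnd.wardTransversal_flipK_TbalOf_JsRowD1_of_wardLetters`.
No `def … : Prop`, nothing cited, 0 sorry; EVERY row, class datum, letter, `hTj`, `hSDF`, `hasym` is a HYPOTHESIS; 0∕4 binders of row D1 discharged;
NOT hW, NOT D1, NOT BetaPertH, NOT continuum, NOT Clay.  ABSOLUTE RULE (cell charter, verbatim): «No internally-minted statement may enter as a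
cited fact. Every hypothesis is either kernel-proved in this package or a verbatim quotation of a PUBLISHED theorem with page reference. The
manuscript(s) under audit are NOT citable for their own disputed steps — they are the thing under adjudication; programme-internal
(2001/route/tribunal) claims are never citable.»

WHY.  The row-D1 owner's decision X-an2-51 fixed the literal of record `JsRowD1 hLc N cΛ cB := JsRecWAtOf …` (an1's TRUE tables); K-Q
(`RowD1JointEnd`) gives hW ∧ hR for it AT EVERY `j` from an1's letters.  Road FP's END is dressing-agnostic (`StepLawWardGeneric`, four-slot
`TGenOf`); its block-mean instance `d1Drift_dressBmAt_of_ward_symm_explicitDefect` asks `hWf`∕`hTsymm` at the perfect triple.  Since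
`JsRecWAtOf = JsRecBmAtOf … (W := WrecAt …) = fun j ↦ dressBmAt ρ_c (JsRec0AtOf … j)` by `rfl`, the literal of record IS a block-mean rooted
dressed family, and the ROW route of `FP/SymmetryInheritGeneric` turns K-Q's finite-`j` hW into the END's `hWf` with NO extra rate data.
CONTENT.
* §1 [our object] `JsRowD1Undressed hLc N cΛ cB : ℕ → JetData 3 Lc` (:= `JsRec0AtOf` at the record's pins ∕ tables); `JsRowD1_eq_dressBmAt` (`rfl`);
  **`TbalOf_JsRowD1`** — the four-family closed form `TbalOf Lc (JsRowD1 …) j = hessKer G_j (vertexOfK G_j Lc S⁰_j) W⁰_j`,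
  `G_j = coDressKBmAt ρ_c Lc (KInvStep Lc j)`, `(S⁰_j, W⁰_j) = ((JsRowD1Undressed … j).S, (JsRowD1Undressed … j).W)`.
* §2 **`d1Drift_JsRowD1_of_rows_wardRow_swapRow_explicitDefect`** — `D1Drift Lc (JsRowD1 hLc N cΛ cB) Nc μ ν` ⟸ EXACTLY {nonzero units; (j,m)-families
  `(G, S, Wt)` with the §1 `m = 1` members; Cauchy rows of the three unit-rescaled `m = 1` families (K-slot: BM-ROWS-type, via asym1's
  `HessKerCoDressedBmWall`; S∕W: the recursive stencils `SpureRecAt`-family and tables `WrecAt` — HYPOTHESES); `0 < R < δK`, `R∕2 < δS`, `R < δW`,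
  `0 ≤ θ < 1`; class data `m ≥ 1`; **hWj** `∀ j, WardTransversal (flipK (TbalOf Lc (JsRowD1 …) j))`; **hTj**; hSDF; hasym}.
* §3 **`d1Drift_JsRowD1_of_rows_wardLetters_swapRow_explicitDefect`** — §2 with **hWj DISCHARGED** by K-Q from an1's three level-0 Ward letters
  ((W-B₀) `hBord0`, (W-B₀″) `hBord0''` for `vh₂SAn1 Lc`; (W-M₀) `hM₂0` for `mixFFAt ρ_c Lc` with residual `RW₀` of `VertexFamily` class, row-parity-odd),
  `2 ≤ N`.  NOT «D1 closed»: the letters are an1's open table laws; the rows and `hTj`∕hSDF∕hasym are open inputs.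
Unit `b2b-balaban-beta-d1-formalise-leaf-01` (gen 6), 2026-08-20; claim table `HOME/b2b-balaban-beta-d1-p3/LEAVES-FP.md` (sub-row ROWD1-PINS).
-/

noncomputable section

namespace Summit.QuantumFields.BalabanUV.Beta.FP.RoadRowD1

open Finset Filter Topology
open scoped BigOperators
open Literature.MathematicalPhysics.QuantumFieldTheory
open Literature.MathematicalPhysics.QuantumFieldTheory.Balaban1983to89
open Literature.MathematicalPhysics.QuantumFieldTheory.Balaban1983to89.Beta
open B12Beta (secondMoment)
open B12Normalization (stepBal)
open DressedMomentNormalisation (EKer dressedEntry)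
open ExpKernelCalculus (MKer Decays VertexFamily VertexFamily₂ hessKer comp)
open KernelWard (divV)
open AffineAveraging (box toSite)
open AveragingContoursRooted (ctr ctrOff ctrOff_mem_box)
open AveragingHessianKernelsRooted (vhSAt)
open AveragingMixedJetTables (mixFFAt)
open PolarizationSign (WardTransversal)
open OneStepResolventKernel (Fib LocStencil JetData)
open OneStepKernelFamily (vertexOfK KInvStep TbalOf flipK D1Drift)
open WilsonVertex2Sym (wsym22)
open BalabanStepW2 (M2Of)
open HessKerDressedLimit (limMKerOf limStOf limTabOf)
open Summit.QuantumFields.BalabanUV.Beta.TameKernelCalculus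
open Summit.QuantumFields.BalabanUV.Beta.HessKerDressedUnits (unitK unitS unitW)
open Summit.QuantumFields.BalabanUV.Beta.BorderedHessian (diagK stepScale sgnK)
open Summit.QuantumFields.BalabanUV.Beta.AveragingWardRootedStencils (legInd)
open Summit.QuantumFields.BalabanUV.Beta.AxialDressingRooted (dressBmAt coDressKBmAt TbalOf_dressBmAt)
open Summit.QuantumFields.BalabanUV.Beta.GAN24.CombesThomas (sfStep smStep)
open Summit.QuantumFields.BalabanUV.Beta.SpineRooted (M1At JsRec0AtOf JsRecWAtOf WrecAt CwRecOf δwRecOf δwRecOf_pos WrecAt_loc₂)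
open Summit.QuantumFields.BalabanUV.Beta.MixedJetTablesPlug (hmix_an1)
open Summit.QuantumFields.BalabanUV.Beta.SecondOrderSocketIdentification (vh₂SAn1)
open Summit.QuantumFields.BalabanUV.Beta.SecondOrderTableLawEnd (locStencil₂_vh₂SAn1)
open Summit.QuantumFields.BalabanUV.Beta.RowD1JointEnd (JsRowD1 wardTransversal_flipK_TbalOf_JsRowD1_of_wardLetters)
open Summit.QuantumFields.BalabanUV.Beta.FP.PerfectObjectsT (KPerf SPerfOf WPerfOf)
open Summit.QuantumFields.BalabanUV.Beta.FP.TransportInfinityM (colOf)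
open Summit.QuantumFields.BalabanUV.Beta.FP.StepDefectInherit (defect)
open Summit.QuantumFields.BalabanUV.Beta.FP.RoadEndGeneric (KPerfOf TGenOf fPerfG)
open Summit.QuantumFields.BalabanUV.Beta.FP.SymmetryInheritGeneric (d1Drift_of_generic_wardRow_swapRow_explicitDefect)
open Summit.QuantumFields.BalabanUV.Beta.GAN24.CombesThomas (sfStep_ne_zero smStep_ne_zero)
open Summit.QuantumFields.BalabanUV.Beta.FP.RoadRebasedHoldsBm (GBm GBm_one hGinf_GBm_holds exists_bm_rows_of_slots)

variable {Lc : ℕ} [NeZero Lc]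

/-! ## §1 The literal of record as a block-mean rooted dressed family and its four-family closed form -/

/-- [our object] **THE UNDRESSED RECURSIVE JETS BEHIND THE LITERAL OF RECORD**: `JsRec0AtOf` at the centred root, pins `(cE, cVH) = (Lc⁴, −Lc⁸∕2)`,
second-order tables `WrecAt` at `cE₂ := Lc⁸`, `cB`, `T_W := (8N²)⁻¹ • wsym22 N`, an1's `vh₂SAn1 Lc`, `mixFFAt ρ_c Lc` (a NAME; nothing asserted). -/
def JsRowD1Undressed (hLc : Odd Lc) (N : ℕ) (cΛ cB : ℝ) : ℕ → JetData 3 Lc :=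
  JsRec0AtOf (d := 3) hLc.pos (ctrOff_mem_box hLc.pos) ((Lc : ℝ) ^ 4) (-((Lc : ℝ) ^ 8 / 2)) cΛ
    (WrecAt 3 Lc (toSite (ctrOff (3 + 1) Lc)) ((Lc : ℝ) ^ 4) (-((Lc : ℝ) ^ 8 / 2)) cΛ ((Lc : ℝ) ^ 8) cB ((8 * (N : ℝ) ^ 2)⁻¹ • wsym22 N)
      (vh₂SAn1 Lc) (mixFFAt (toSite (ctrOff (3 + 1) Lc)) Lc))
    (CwRecOf hLc.pos (ctrOff_mem_box hLc.pos) ((Lc : ℝ) ^ 4) (-((Lc : ℝ) ^ 8 / 2)) cΛ ((Lc : ℝ) ^ 8) cB ((8 * (N : ℝ) ^ 2)⁻¹ • wsym22 N)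
      (locStencil₂_vh₂SAn1 hLc) (hmix_an1 (d := 3) hLc.pos (ctrOff_mem_box hLc.pos)))
    (δwRecOf hLc.pos (ctrOff_mem_box hLc.pos) ((Lc : ℝ) ^ 4) (-((Lc : ℝ) ^ 8 / 2)) cΛ ((Lc : ℝ) ^ 8) cB ((8 * (N : ℝ) ^ 2)⁻¹ • wsym22 N)
      (locStencil₂_vh₂SAn1 hLc) (hmix_an1 (d := 3) hLc.pos (ctrOff_mem_box hLc.pos)))
    (δwRecOf_pos hLc.pos (ctrOff_mem_box hLc.pos) ((Lc : ℝ) ^ 4) (-((Lc : ℝ) ^ 8 / 2)) cΛ ((Lc : ℝ) ^ 8) cB ((8 * (N : ℝ) ^ 2)⁻¹ • wsym22 N)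
      (locStencil₂_vh₂SAn1 hLc) (hmix_an1 (d := 3) hLc.pos (ctrOff_mem_box hLc.pos)))
    (WrecAt_loc₂ hLc.pos (ctrOff_mem_box hLc.pos) ((Lc : ℝ) ^ 4) (-((Lc : ℝ) ^ 8 / 2)) cΛ ((Lc : ℝ) ^ 8) cB ((8 * (N : ℝ) ^ 2)⁻¹ • wsym22 N)
      (locStencil₂_vh₂SAn1 hLc) (hmix_an1 (d := 3) hLc.pos (ctrOff_mem_box hLc.pos)))

/-- [our object] **THE LITERAL OF RECORD IS A BLOCK-MEAN ROOTED DRESSED FAMILY**: `JsRowD1 hLc N cΛ cB = fun j ↦ dressBmAt ρ_c (JsRowD1Undressed … j)`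
— by `rfl` (`JsRowD1 := JsRecWAtOf …`, `JsRecWAtOf := JsRecBmAtOf … (W := WrecAt …)`, `JsRecBmAtOf := fun j ↦ dressBmAt _ (JsRec0AtOf … j)`). -/
theorem JsRowD1_eq_dressBmAt (hLc : Odd Lc) (N : ℕ) (cΛ cB : ℝ) :
    JsRowD1 hLc N cΛ cB = fun j => dressBmAt (ctrOff_mem_box hLc.pos) (JsRowD1Undressed hLc N cΛ cB j) := rfl

/-- [folklore] **THE FOUR-FAMILY CLOSED FORM OF THE LITERAL OF RECORD** (an2's `TbalOf_dressBmAt`): for every `j`,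
`TbalOf Lc (JsRowD1 …) j = hessKer G_j (vertexOfK G_j Lc (JsRowD1Undressed … j).S) (JsRowD1Undressed … j).W`, `G_j = coDressKBmAt ρ_c Lc (KInvStep Lc j)`. -/
theorem TbalOf_JsRowD1 (hLc : Odd Lc) (N : ℕ) (cΛ cB : ℝ) (j : ℕ) :
    TbalOf Lc (JsRowD1 hLc N cΛ cB) j =
      hessKer (coDressKBmAt (toSite (ctrOff (3 + 1) Lc)) Lc (KInvStep (d := 3) Lc j))
        (vertexOfK (coDressKBmAt (toSite (ctrOff (3 + 1) Lc)) Lc (KInvStep (d := 3) Lc j)) Lc (JsRowD1Undressed hLc N cΛ cB j).S)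
        (JsRowD1Undressed hLc N cΛ cB j).W := by
  rw [JsRowD1_eq_dressBmAt]
  exact TbalOf_dressBmAt (ctrOff_mem_box hLc.pos) (JsRowD1Undressed hLc N cΛ cB) j

/-! ## §2 Road FP's END at the literal of record, symmetry sockets from the finite-`j` rows -/

section End

variable (hLc : Odd Lc) (N : ℕ) (cΛ cB : ℝ) (sf sm : ℕ → ℝ) (G : ℕ → ℕ → MKer (3 + 1) (Fib 3))
  (S : ℕ → ℕ → Fin (3 + 1) → (Fin (3 + 1) → ℤ) → MKer (3 + 1) (Fib 3))
  (Wt : ℕ → ℕ → Fin (3 + 1) → (Fin (3 + 1) → ℤ) → Fin (3 + 1) → (Fin (3 + 1) → ℤ) → MKer (3 + 1) (Fib 3))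
  {R C cK δK Cs cS δS Cw cW δW θ : ℝ}

/-- **ROAD «FP» AT THE LITERAL OF RECORD — `D1Drift Lc (JsRowD1 hLc N cΛ cB) Nc μ ν` FROM THE ROWS + THE WALL's SYMMETRY ROWS** (`2 ≤ Lc`, odd `Lc`;
bounded-defect form).  Residual: nonzero units; (j, m)-families `(G, S, Wt)` with `m = 1` members `(coDressKBmAt ρ_c Lc (KInvStep Lc j), S⁰_j, W⁰_j)`;
Cauchy rows on the three unit-rescaled `m = 1` families; class data (`m ≥ 1`); **hWj**, **hTj** (finite-`j` Ward ∕ transposition rows of the wall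
kernels); hSDF; hasym — `SymmetryInheritGeneric.d1Drift_of_generic_wardRow_swapRow_explicitDefect` at the closed form `TbalOf_JsRowD1`. [our object] -/
theorem d1Drift_JsRowD1_of_rows_wardRow_swapRow_explicitDefect (hLc2 : 2 ≤ Lc) (hsf : ∀ j, sf j ≠ 0) (hsm : ∀ j, sm j ≠ 0)
    (hG1 : ∀ j, G j 1 = coDressKBmAt (toSite (ctrOff (3 + 1) Lc)) Lc (KInvStep (d := 3) Lc j))
    (hS1 : ∀ j, S j 1 = (JsRowD1Undressed hLc N cΛ cB j).S) (hW1 : ∀ j, Wt j 1 = (JsRowD1Undressed hLc N cΛ cB j).W)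
    (hK : ∀ j, Decays (unitK (sf j) (sm j) (coDressKBmAt (toSite (ctrOff (3 + 1) Lc)) Lc (KInvStep (d := 3) Lc j))) C δK)
    (hKall : ∀ k j, Decays (unitK (sf (k + j)) (sm (k + j)) (coDressKBmAt (toSite (ctrOff (3 + 1) Lc)) Lc (KInvStep (d := 3) Lc (k + j))) -
      unitK (sf k) (sm k) (coDressKBmAt (toSite (ctrOff (3 + 1) Lc)) Lc (KInvStep (d := 3) Lc k))) (cK * θ ^ k) δK)
    (hS : ∀ j, LocStencil (unitS (sf j) (sm j) (JsRowD1Undressed hLc N cΛ cB j).S) Cs δS)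
    (hSall : ∀ k j, LocStencil (unitS (sf (k + j)) (sm (k + j)) (JsRowD1Undressed hLc N cΛ cB (k + j)).S -
      unitS (sf k) (sm k) (JsRowD1Undressed hLc N cΛ cB k).S) (cS * θ ^ k) δS)
    (hW : ∀ j, VertexFamily₂ (unitW (sf j) (sm j) (JsRowD1Undressed hLc N cΛ cB j).W) Lc Cw δW)
    (hWall : ∀ k j, VertexFamily₂ (unitW (sf (k + j)) (sm (k + j)) (JsRowD1Undressed hLc N cΛ cB (k + j)).W -
      unitW (sf k) (sm k) (JsRowD1Undressed hLc N cΛ cB k).W) Lc (cW * θ ^ k) δW)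
    (hR : 0 < R) (hRK : R < δK) (hRS : R / 2 < δS) (hRW : R < δW) (hθ0 : 0 ≤ θ) (hθ1 : θ < 1)
    (hGinf : ∀ m : ℕ, 1 ≤ m → ∃ δ C : ℝ, 0 < δ ∧ 0 ≤ C ∧ Decays (KPerfOf (d := 3) sf sm G m) C δ)
    (hSinf : ∀ m : ℕ, 1 ≤ m → ∃ Cs δS : ℝ, 0 < δS ∧ LocStencil (SPerfOf sf sm S m) Cs δS)
    (hWinf : ∀ m : ℕ, 1 ≤ m → ∃ Cw δW : ℝ, 0 < δW ∧ VertexFamily₂ (WPerfOf sf sm Wt m) (Lc ^ m) Cw δW)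
    (hWj : ∀ j, WardTransversal (flipK (TbalOf Lc (JsRowD1 hLc N cΛ cB) j)))
    (hTj : ∀ j a b t, TbalOf Lc (JsRowD1 hLc N cΛ cB) j a b t = TbalOf Lc (JsRowD1 hLc N cΛ cB) j b a (-t))
    (μ ν : Fin 4)
    (hSDF : ∀ m : ℕ, 1 ≤ m → secondMoment (defect
      (fun m => TGenOf (Lc ^ m) (KPerfOf sf sm G m) (KPerfOf sf sm G m) (SPerfOf sf sm S m) (WPerfOf sf sm Wt m))
      (fun m a b z => ((Lc ^ m : ℕ) : ℝ) ^ 8 * dressedEntry (colOf (KPerf (d := 3) Lc (sfStep Lc) (smStep 3 Lc) m))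
        (TGenOf Lc (KPerfOf sf sm G 1) (KPerfOf sf sm G 1) (SPerfOf sf sm S 1) (WPerfOf sf sm Wt 1))
        (((Lc ^ m : ℕ) : ℤ) • z) a b) m) μ ν = 0)
    {Nc Cg : ℝ} (hasym : ∀ m : ℕ, 1 ≤ m → |fPerfG Lc sf sm G G S Wt μ ν m - (m : ℝ) * stepBal Nc Lc| ≤ Cg) :
    D1Drift Lc (JsRowD1 hLc N cΛ cB) Nc μ ν :=
  d1Drift_of_generic_wardRow_swapRow_explicitDefect (JsRowD1 hLc N cΛ cB) sf sm G G S Wt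
    (A1 := fun j => coDressKBmAt (toSite (ctrOff (3 + 1) Lc)) Lc (KInvStep (d := 3) Lc j))
    (G1 := fun j => coDressKBmAt (toSite (ctrOff (3 + 1) Lc)) Lc (KInvStep (d := 3) Lc j))
    (S1 := fun j => (JsRowD1Undressed hLc N cΛ cB j).S) (W1 := fun j => (JsRowD1Undressed hLc N cΛ cB j).W)
    hLc2 hsf hsm (TbalOf_JsRowD1 hLc N cΛ cB) hG1 hG1 hS1 hW1 hK hKall hK hKall hS hSall hW hWall hR hRK hRS hRW hθ0 hθ1 hGinf hGinf hSinf
    hWinf hWj hTj μ ν hSDF hasym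

/-! ## §3 … with the Ward row DISCHARGED by K-Q from an1's three level-0 Ward letters -/

/-- **ROAD «FP» AT THE LITERAL OF RECORD, THE WARD ROW FROM an1's THREE LEVEL-0 WARD LETTERS** (`2 ≤ N`, `2 ≤ Lc`, odd `Lc`): §2 with
`hWj := RowD1JointEnd.wardTransversal_flipK_TbalOf_JsRowD1_of_wardLetters` ((W-B₀) `hBord0` ∕ (W-B₀″) `hBord0''` for `vh₂SAn1 Lc`, (W-M₀) `hM₂0` for
`mixFFAt ρ_c Lc` with residual `RW₀` of `VertexFamily` class, row-parity-odd — VERBATIM K-Q's shapes).  Residual: {rows, class data, the THREE hW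
LETTERS, hTj, hSDF, hasym}.  NOT «D1 closed». [our object] -/
theorem d1Drift_JsRowD1_of_rows_wardLetters_swapRow_explicitDefect (hLc2 : 2 ≤ Lc) (hN : 2 ≤ N)
    (hsf : ∀ j, sf j ≠ 0) (hsm : ∀ j, sm j ≠ 0)
    (hG1 : ∀ j, G j 1 = coDressKBmAt (toSite (ctrOff (3 + 1) Lc)) Lc (KInvStep (d := 3) Lc j))
    (hS1 : ∀ j, S j 1 = (JsRowD1Undressed hLc N cΛ cB j).S) (hW1 : ∀ j, Wt j 1 = (JsRowD1Undressed hLc N cΛ cB j).W)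
    (hK : ∀ j, Decays (unitK (sf j) (sm j) (coDressKBmAt (toSite (ctrOff (3 + 1) Lc)) Lc (KInvStep (d := 3) Lc j))) C δK)
    (hKall : ∀ k j, Decays (unitK (sf (k + j)) (sm (k + j)) (coDressKBmAt (toSite (ctrOff (3 + 1) Lc)) Lc (KInvStep (d := 3) Lc (k + j))) -
      unitK (sf k) (sm k) (coDressKBmAt (toSite (ctrOff (3 + 1) Lc)) Lc (KInvStep (d := 3) Lc k))) (cK * θ ^ k) δK)
    (hS : ∀ j, LocStencil (unitS (sf j) (sm j) (JsRowD1Undressed hLc N cΛ cB j).S) Cs δS)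
    (hSall : ∀ k j, LocStencil (unitS (sf (k + j)) (sm (k + j)) (JsRowD1Undressed hLc N cΛ cB (k + j)).S -
      unitS (sf k) (sm k) (JsRowD1Undressed hLc N cΛ cB k).S) (cS * θ ^ k) δS)
    (hW : ∀ j, VertexFamily₂ (unitW (sf j) (sm j) (JsRowD1Undressed hLc N cΛ cB j).W) Lc Cw δW)
    (hWall : ∀ k j, VertexFamily₂ (unitW (sf (k + j)) (sm (k + j)) (JsRowD1Undressed hLc N cΛ cB (k + j)).W -
      unitW (sf k) (sm k) (JsRowD1Undressed hLc N cΛ cB k).W) Lc (cW * θ ^ k) δW)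
    (hR : 0 < R) (hRK : R < δK) (hRS : R / 2 < δS) (hRW : R < δW) (hθ0 : 0 ≤ θ) (hθ1 : θ < 1)
    (hGinf : ∀ m : ℕ, 1 ≤ m → ∃ δ C : ℝ, 0 < δ ∧ 0 ≤ C ∧ Decays (KPerfOf (d := 3) sf sm G m) C δ)
    (hSinf : ∀ m : ℕ, 1 ≤ m → ∃ Cs δS : ℝ, 0 < δS ∧ LocStencil (SPerfOf sf sm S m) Cs δS)
    (hWinf : ∀ m : ℕ, 1 ≤ m → ∃ Cw δW : ℝ, 0 < δW ∧ VertexFamily₂ (WPerfOf sf sm Wt m) (Lc ^ m) Cw δW)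
    -- an1's three level-0 hW LETTERS (K-Q's shapes VERBATIM)
    {RW₀ : (Fin (3 + 1) → ℤ) → Fin (3 + 1) → (Fin (3 + 1) → ℤ) → MKer (3 + 1) (Fib 3)}
    (hclsW₀ : ∃ C δ : ℝ, 0 < δ ∧ ∀ y, VertexFamily (RW₀ y) Lc C δ)
    (hRW₀p : ∀ y ρ' w, trK (RW₀ y ρ' w) = -sgnK (RW₀ y ρ' w))
    (hBord0 : ∀ (Y : Fin (3 + 1) → ℤ) (κ' : Fin (3 + 1)) (u' : Fin (3 + 1) → ℤ),
      (stepScale 3 Lc 0 * (Lc : ℝ) ^ (3 + 1))⁻¹ • ∑ v ∈ box (3 + 1) Lc, divV (fun κ u => cB • vh₂SAn1 Lc κ u κ' u') ((Lc : ℤ) • Y + toSite v) =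
        comp ((-((Lc : ℝ) ^ (3 + 1) * (1 / 2) * (Lc : ℝ) ^ (3 + 1))) • vhSAt (toSite (ctrOff 4 Lc)) 3 Lc rfl κ' u')
            (diagK (((1 : ℝ) / 2) • ∑ v ∈ box (3 + 1) Lc, legInd (toSite (ctrOff 4 Lc)) ((Lc : ℤ) • Y + toSite v)))
          - comp (diagK (((1 : ℝ) / 2) • ∑ v ∈ box (3 + 1) Lc, legInd (toSite (ctrOff 4 Lc)) ((Lc : ℤ) • Y + toSite v)))
            ((-((Lc : ℝ) ^ (3 + 1) * (1 / 2) * (Lc : ℝ) ^ (3 + 1))) • vhSAt (toSite (ctrOff 4 Lc)) 3 Lc rfl κ' u'))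
    (hBord0'' : ∀ (Y : Fin (3 + 1) → ℤ) (κ : Fin (3 + 1)) (u : Fin (3 + 1) → ℤ),
      (stepScale 3 Lc 0 * (Lc : ℝ) ^ (3 + 1))⁻¹ • ∑ v ∈ box (3 + 1) Lc, divV (fun κ' u' => cB • vh₂SAn1 Lc κ u κ' u') ((Lc : ℤ) • Y + toSite v) =
        comp ((-((Lc : ℝ) ^ (3 + 1) * (1 / 2) * (Lc : ℝ) ^ (3 + 1))) • vhSAt (toSite (ctrOff 4 Lc)) 3 Lc rfl κ u)
            (diagK (((1 : ℝ) / 2) • ∑ v ∈ box (3 + 1) Lc, legInd (toSite (ctrOff 4 Lc)) ((Lc : ℤ) • Y + toSite v)))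
          - comp (diagK (((1 : ℝ) / 2) • ∑ v ∈ box (3 + 1) Lc, legInd (toSite (ctrOff 4 Lc)) ((Lc : ℤ) • Y + toSite v)))
            ((-((Lc : ℝ) ^ (3 + 1) * (1 / 2) * (Lc : ℝ) ^ (3 + 1))) • vhSAt (toSite (ctrOff 4 Lc)) 3 Lc rfl κ u))
    (hM₂0 : ∀ (y : Fin (3 + 1) → ℤ) (ρ' : Fin (3 + 1)) (w : Fin (3 + 1) → ℤ),
      (stepScale 3 Lc 0 * (Lc : ℝ) ^ (3 + 1))⁻¹ • ∑ v ∈ box (3 + 1) Lc,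
          divV (fun κ u => M2Of 3 Lc (mixFFAt (toSite (ctrOff 4 Lc)) Lc) 0 κ u ρ' w) ((Lc : ℤ) • y + toSite v) =
        comp (M1At 3 Lc (toSite (ctrOff 4 Lc)) cΛ 0 ρ' w) (diagK (((1 : ℝ) / 2) • ∑ v ∈ box (3 + 1) Lc, legInd (toSite (ctrOff 4 Lc)) ((Lc : ℤ) • y + toSite v)))
          - comp (diagK (((1 : ℝ) / 2) • ∑ v ∈ box (3 + 1) Lc, legInd (toSite (ctrOff 4 Lc)) ((Lc : ℤ) • y + toSite v)))
            (M1At 3 Lc (toSite (ctrOff 4 Lc)) cΛ 0 ρ' w)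
          + RW₀ y ρ' w)
    (hTj : ∀ j a b t, TbalOf Lc (JsRowD1 hLc N cΛ cB) j a b t = TbalOf Lc (JsRowD1 hLc N cΛ cB) j b a (-t))
    (μ ν : Fin 4)
    (hSDF : ∀ m : ℕ, 1 ≤ m → secondMoment (defect
      (fun m => TGenOf (Lc ^ m) (KPerfOf sf sm G m) (KPerfOf sf sm G m) (SPerfOf sf sm S m) (WPerfOf sf sm Wt m))
      (fun m a b z => ((Lc ^ m : ℕ) : ℝ) ^ 8 * dressedEntry (colOf (KPerf (d := 3) Lc (sfStep Lc) (smStep 3 Lc) m))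
        (TGenOf Lc (KPerfOf sf sm G 1) (KPerfOf sf sm G 1) (SPerfOf sf sm S 1) (WPerfOf sf sm Wt 1))
        (((Lc ^ m : ℕ) : ℤ) • z) a b) m) μ ν = 0)
    {Nc Cg : ℝ} (hasym : ∀ m : ℕ, 1 ≤ m → |fPerfG Lc sf sm G G S Wt μ ν m - (m : ℝ) * stepBal Nc Lc| ≤ Cg) :
    D1Drift Lc (JsRowD1 hLc N cΛ cB) Nc μ ν :=
  d1Drift_JsRowD1_of_rows_wardRow_swapRow_explicitDefect hLc N cΛ cB sf sm G S Wt hLc2 hsf hsm hG1 hS1 hW1 hK hKall hS hSall hW hWall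
    hR hRK hRS hRW hθ0 hθ1 hGinf hSinf hWinf
    (wardTransversal_flipK_TbalOf_JsRowD1_of_wardLetters hLc hN cΛ cB hclsW₀ hRW₀p hBord0 hBord0'' hM₂0) hTj μ ν hSDF hasym

/-! ## §4 … in the ADOPTED UNITS with the K-SIDE DISCHARGED by BM-ROWS (`FP.RoadRebasedHoldsBm`) -/

/-- **ROAD «FP» AT THE LITERAL OF RECORD, ADOPTED UNITS, K-SIDE AND WARD ROW DISCHARGED** (`2 ≤ N`, `2 ≤ Lc`, odd `Lc`; `sf := sfStep Lc`,
`sm := smStep 3 Lc`, `G := GBm ρ_c Lc`): §3 with the K-slot rows, the merged window and the K class datum `hGinf` supplied BY NAME by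
`RoadRebasedHoldsBm.exists_bm_rows_of_slots` ∕ `GBm_one` ∕ `hGinf_GBm_holds` at the in-block root `ctrOff (3+1) Lc` (pattern of
`RoadRebasedHoldsBm.d1Drift_dressBmAt_of_slots_ward_symm_explicitDefect`).  Residual, EXACTLY: {pins `hS1`∕`hW1`, the S- and W-slot rows of the
UNDRESSED recursive jets `JsRowD1Undressed` in the adopted units (each at its own rate), class data `hSinf`∕`hWinf`, an1's THREE hW LETTERS, hTj,
hSDF, hasym}.  NOT «D1 closed»; 0∕4 row-D1 binders. [our object] -/
theorem d1Drift_JsRowD1_of_slots_wardLetters_swapRow_explicitDefect (hLc2 : 2 ≤ Lc) (hN : 2 ≤ N) {θS θW : ℝ}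
    (hS1 : ∀ j, S j 1 = (JsRowD1Undressed hLc N cΛ cB j).S) (hW1 : ∀ j, Wt j 1 = (JsRowD1Undressed hLc N cΛ cB j).W)
    (hS : ∀ j, LocStencil (unitS (sfStep Lc j) (smStep 3 Lc j) (JsRowD1Undressed hLc N cΛ cB j).S) Cs δS)
    (hSall : ∀ k j, LocStencil (unitS (sfStep Lc (k + j)) (smStep 3 Lc (k + j)) (JsRowD1Undressed hLc N cΛ cB (k + j)).S -
      unitS (sfStep Lc k) (smStep 3 Lc k) (JsRowD1Undressed hLc N cΛ cB k).S) (cS * θS ^ k) δS)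
    (hW : ∀ j, VertexFamily₂ (unitW (sfStep Lc j) (smStep 3 Lc j) (JsRowD1Undressed hLc N cΛ cB j).W) Lc Cw δW)
    (hWall : ∀ k j, VertexFamily₂ (unitW (sfStep Lc (k + j)) (smStep 3 Lc (k + j)) (JsRowD1Undressed hLc N cΛ cB (k + j)).W -
      unitW (sfStep Lc k) (smStep 3 Lc k) (JsRowD1Undressed hLc N cΛ cB k).W) Lc (cW * θW ^ k) δW)
    (hδS : 0 < δS) (hδW : 0 < δW) (hθS0 : 0 ≤ θS) (hθS1 : θS < 1) (hθW0 : 0 ≤ θW) (hθW1 : θW < 1)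
    (hSinf : ∀ m : ℕ, 1 ≤ m → ∃ Cs' δS' : ℝ, 0 < δS' ∧ LocStencil (SPerfOf (sfStep Lc) (smStep 3 Lc) S m) Cs' δS')
    (hWinf : ∀ m : ℕ, 1 ≤ m → ∃ Cw' δW' : ℝ, 0 < δW' ∧ VertexFamily₂ (WPerfOf (sfStep Lc) (smStep 3 Lc) Wt m) (Lc ^ m) Cw' δW')
    -- an1's three level-0 hW LETTERS (K-Q's shapes VERBATIM)
    {RW₀ : (Fin (3 + 1) → ℤ) → Fin (3 + 1) → (Fin (3 + 1) → ℤ) → MKer (3 + 1) (Fib 3)}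
    (hclsW₀ : ∃ C δ : ℝ, 0 < δ ∧ ∀ y, VertexFamily (RW₀ y) Lc C δ)
    (hRW₀p : ∀ y ρ' w, trK (RW₀ y ρ' w) = -sgnK (RW₀ y ρ' w))
    (hBord0 : ∀ (Y : Fin (3 + 1) → ℤ) (κ' : Fin (3 + 1)) (u' : Fin (3 + 1) → ℤ),
      (stepScale 3 Lc 0 * (Lc : ℝ) ^ (3 + 1))⁻¹ • ∑ v ∈ box (3 + 1) Lc, divV (fun κ u => cB • vh₂SAn1 Lc κ u κ' u') ((Lc : ℤ) • Y + toSite v) =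
        comp ((-((Lc : ℝ) ^ (3 + 1) * (1 / 2) * (Lc : ℝ) ^ (3 + 1))) • vhSAt (toSite (ctrOff 4 Lc)) 3 Lc rfl κ' u')
            (diagK (((1 : ℝ) / 2) • ∑ v ∈ box (3 + 1) Lc, legInd (toSite (ctrOff 4 Lc)) ((Lc : ℤ) • Y + toSite v)))
          - comp (diagK (((1 : ℝ) / 2) • ∑ v ∈ box (3 + 1) Lc, legInd (toSite (ctrOff 4 Lc)) ((Lc : ℤ) • Y + toSite v)))
            ((-((Lc : ℝ) ^ (3 + 1) * (1 / 2) * (Lc : ℝ) ^ (3 + 1))) • vhSAt (toSite (ctrOff 4 Lc)) 3 Lc rfl κ' u'))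
    (hBord0'' : ∀ (Y : Fin (3 + 1) → ℤ) (κ : Fin (3 + 1)) (u : Fin (3 + 1) → ℤ),
      (stepScale 3 Lc 0 * (Lc : ℝ) ^ (3 + 1))⁻¹ • ∑ v ∈ box (3 + 1) Lc, divV (fun κ' u' => cB • vh₂SAn1 Lc κ u κ' u') ((Lc : ℤ) • Y + toSite v) =
        comp ((-((Lc : ℝ) ^ (3 + 1) * (1 / 2) * (Lc : ℝ) ^ (3 + 1))) • vhSAt (toSite (ctrOff 4 Lc)) 3 Lc rfl κ u)
            (diagK (((1 : ℝ) / 2) • ∑ v ∈ box (3 + 1) Lc, legInd (toSite (ctrOff 4 Lc)) ((Lc : ℤ) • Y + toSite v)))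
          - comp (diagK (((1 : ℝ) / 2) • ∑ v ∈ box (3 + 1) Lc, legInd (toSite (ctrOff 4 Lc)) ((Lc : ℤ) • Y + toSite v)))
            ((-((Lc : ℝ) ^ (3 + 1) * (1 / 2) * (Lc : ℝ) ^ (3 + 1))) • vhSAt (toSite (ctrOff 4 Lc)) 3 Lc rfl κ u))
    (hM₂0 : ∀ (y : Fin (3 + 1) → ℤ) (ρ' : Fin (3 + 1)) (w : Fin (3 + 1) → ℤ),
      (stepScale 3 Lc 0 * (Lc : ℝ) ^ (3 + 1))⁻¹ • ∑ v ∈ box (3 + 1) Lc,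
          divV (fun κ u => M2Of 3 Lc (mixFFAt (toSite (ctrOff 4 Lc)) Lc) 0 κ u ρ' w) ((Lc : ℤ) • y + toSite v) =
        comp (M1At 3 Lc (toSite (ctrOff 4 Lc)) cΛ 0 ρ' w) (diagK (((1 : ℝ) / 2) • ∑ v ∈ box (3 + 1) Lc, legInd (toSite (ctrOff 4 Lc)) ((Lc : ℤ) • y + toSite v)))
          - comp (diagK (((1 : ℝ) / 2) • ∑ v ∈ box (3 + 1) Lc, legInd (toSite (ctrOff 4 Lc)) ((Lc : ℤ) • y + toSite v)))
            (M1At 3 Lc (toSite (ctrOff 4 Lc)) cΛ 0 ρ' w)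
          + RW₀ y ρ' w)
    (hTj : ∀ j a b t, TbalOf Lc (JsRowD1 hLc N cΛ cB) j a b t = TbalOf Lc (JsRowD1 hLc N cΛ cB) j b a (-t))
    (μ ν : Fin 4)
    (hSDF : ∀ m : ℕ, 1 ≤ m → secondMoment (defect
      (fun m => TGenOf (Lc ^ m) (KPerfOf (sfStep Lc) (smStep 3 Lc) (GBm (ctrOff (3 + 1) Lc) Lc) m)
        (KPerfOf (sfStep Lc) (smStep 3 Lc) (GBm (ctrOff (3 + 1) Lc) Lc) m)
        (SPerfOf (sfStep Lc) (smStep 3 Lc) S m) (WPerfOf (sfStep Lc) (smStep 3 Lc) Wt m))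
      (fun m a b z => ((Lc ^ m : ℕ) : ℝ) ^ 8 * dressedEntry (colOf (KPerf (d := 3) Lc (sfStep Lc) (smStep 3 Lc) m))
        (TGenOf Lc (KPerfOf (sfStep Lc) (smStep 3 Lc) (GBm (ctrOff (3 + 1) Lc) Lc) 1)
          (KPerfOf (sfStep Lc) (smStep 3 Lc) (GBm (ctrOff (3 + 1) Lc) Lc) 1)
          (SPerfOf (sfStep Lc) (smStep 3 Lc) S 1) (WPerfOf (sfStep Lc) (smStep 3 Lc) Wt 1))
        (((Lc ^ m : ℕ) : ℤ) • z) a b) m) μ ν = 0)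
    {Nc Cg : ℝ}
    (hasym : ∀ m : ℕ, 1 ≤ m →
      |fPerfG Lc (sfStep Lc) (smStep 3 Lc) (GBm (ctrOff (3 + 1) Lc) Lc) (GBm (ctrOff (3 + 1) Lc) Lc) S Wt μ ν m - (m : ℝ) * stepBal Nc Lc| ≤ Cg) :
    D1Drift Lc (JsRowD1 hLc N cΛ cB) Nc μ ν := by
  obtain ⟨C, δK, cK, θ, R, hR, hRK, hRS, hRW, hθ0, hθ1, hK, hKall, hSall', hWall'⟩ :=
    exists_bm_rows_of_slots (Lc := Lc) hLc2 (ctrOff_mem_box hLc.pos)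
      (S := fun j => unitS (sfStep Lc j) (smStep 3 Lc j) (JsRowD1Undressed hLc N cΛ cB j).S)
      (W := fun j => unitW (sfStep Lc j) (smStep 3 Lc j) (JsRowD1Undressed hLc N cΛ cB j).W)
      hSall hWall hδS hδW hθS0 hθS1 hθW0 hθW1
  exact d1Drift_JsRowD1_of_rows_wardLetters_swapRow_explicitDefect hLc N cΛ cB (sfStep Lc) (smStep 3 Lc) (GBm (ctrOff (3 + 1) Lc) Lc) S Wt
    hLc2 hN sfStep_ne_zero smStep_ne_zero (GBm_one _ Lc) hS1 hW1 hK hKall hS hSall' hW hWall' hR hRK hRS hRW hθ0 hθ1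
    (hGinf_GBm_holds hLc2 (ctrOff_mem_box hLc.pos)) hSinf hWinf hclsW₀ hRW₀p hBord0 hBord0'' hM₂0 hTj μ ν hSDF hasym

end End

end Summit.QuantumFields.BalabanUV.Beta.FP.RoadRowD1

end
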